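import Literature.Computability.AlgebraicComplexity.BI17FundamentalInvariantForms
import Mathlib.LinearAlgebra.Matrix.Permutation
import HarnessLib

/-!
# BI 2017, Prop. 2.4(1): the stabilizer of `X_1 ⋯ X_m` — discharge of `BI2017_prop_2_4_1`

Sibling proofs file of `BI17FundamentalInvariantForms.lean` (val-lit cell, D-0074 GROUP L, row
`BI2017-A`; P. Bürgisser, C. Ikenmeyer, *Fundamental invariants of orbit closures*, J. Algebra 477
(2017) = arXiv:1511.02927, Prop. 2.4(1), "well-known"): "The stabilizer of `X_1⋯X_m` is generated by
the permutation matrices and the diagonal matrices with determinant one. The stabilizer period of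
`X_1⋯X_m` equals `2` if `m ≥ 2`." The parent file types it as the named fact `BI2017_prop_2_4_1`
(`linStabilizer (∏ X_i) = Subgroup.closure (permutation matrices ∪ det-one diagonal matrices)` and
`stabilizerPeriod (∏ X_i) = 2` for `m ≥ 2`, `stabilizerPeriod` = `Nat.card` of the image of the
stabilizer under `det`). It is PROVED here (`BI2017_prop_2_4_1_holds`).

Proof (elementary; no unique factorisation is used). The substitution by `γ` maps `X_1⋯X_m` to
`∏_i L_i`, `L_i = ∑_j γ_{ji} X_j`. If this equals `X_1⋯X_m`, then killing the variable `X_j`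
(the algebra map `X_j ↦ 0`) kills the product, so some factor `L_i` becomes `0`, i.e. the column `i`
of `γ` is supported on the row `j` alone; distinct `j` give distinct `i` (a column supported on two
different single rows is zero, impossible for an invertible `γ`), so `j ↦ i` is a permutation and
`γ = P_π · diag(c)` is a monomial matrix (`exists_perm_diagonal_of_mem_linStabilizer_prodX`); then
`∏ L_i = (∏ c_i) · X_1⋯X_m` forces `∏ c_i = 1`. Conversely permutation matrices and det-one diagonal
matrices stabilize `X_1⋯X_m`. The determinants of the stabilizer are the `sign(π) · ∏ c_i = ±1`, and
`-1` occurs for `m ≥ 2` (a transposition), so the image of `det` is `{1, -1}`, of cardinality `2`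
in characteristic zero. Typed literature; `VP ≠ VNP` is not proved and nothing here is progress on it.

## References
* [BurgisserIkenmeyer2017] P. Bürgisser, C. Ikenmeyer, J. Algebra 477 (2017) 390–434 =
  arXiv:1511.02927, §2.1 Prop. 2.4(1) (TeX L494; held p0006:L76).
-/

noncomputable section

open MvPolynomial Matrix

namespace Literature.Computability.AlgebraicComplexity

section ChowMonomialStabilizer

variable {k : Type*} [Field k] {m : ℕ}

/-- The entries of a permutation matrix: `P_π j i = [π j = i]` (private helper). [folklore] -/
private theorem permMatrix_apply' (π : Equiv.Perm (Fin m)) (j i : Fin m) :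
    π.permMatrix k j i = if π j = i then 1 else 0 := by
  rw [Equiv.Perm.permMatrix, PEquiv.toMatrix_toPEquiv_apply, Pi.single_apply]
  by_cases h : π j = i
  · rw [if_pos h, if_pos h.symm]
  · rw [if_neg h, if_neg (Ne.symm h)]

/-- Linear substitution of a product of variables (private helper). [folklore] -/
private theorem linSubst_prodX_eq_prod_sum (A : Matrix (Fin m) (Fin m) k) :
    linSubst (Fin m) k A (∏ i : Fin m, X i) =
      ∏ i : Fin m, ∑ j : Fin m, A j i • (X j : MvPolynomial (Fin m) k) := by
  rw [map_prod]
  exact Finset.prod_congr rfl fun i _ => linSubst_X (Fin m) k A i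

/-- A monomial matrix `P_π · diag(c)` substitutes `X_i ↦ c_i X_{π⁻¹ i}` (private helper).
[folklore] -/
private theorem linSubst_permMatrix_mul_diagonal_X (π : Equiv.Perm (Fin m)) (c : Fin m → k)
    (i : Fin m) :
    linSubst (Fin m) k (π.permMatrix k * diagonal c) (X i) =
      c i • (X (π.symm i) : MvPolynomial (Fin m) k) := by
  rw [linSubst_X, Finset.sum_eq_single (π.symm i)]
  · rw [mul_diagonal, permMatrix_apply', Equiv.apply_symm_apply, if_pos rfl, one_mul]
  · intro j _ hj
    rw [mul_diagonal, permMatrix_apply', if_neg, zero_mul, zero_smul]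
    intro h
    exact hj (by rw [← h, Equiv.symm_apply_apply])
  · intro h
    exact absurd (Finset.mem_univ _) h

/-- A monomial matrix `P_π · diag(c)` maps `X_1⋯X_m` to `(∏ c_i) · X_1⋯X_m` (private helper).
[folklore] -/
private theorem linSubst_permMatrix_mul_diagonal_prodX (π : Equiv.Perm (Fin m)) (c : Fin m → k) :
    linSubst (Fin m) k (π.permMatrix k * diagonal c) (∏ i : Fin m, X i) =
      (∏ i, c i) • (∏ i : Fin m, (X i : MvPolynomial (Fin m) k)) := by
  rw [map_prod]
  simp_rw [linSubst_permMatrix_mul_diagonal_X, smul_eq_C_mul]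
  rw [Finset.prod_mul_distrib, ← map_prod, Equiv.prod_comp π.symm (fun i => (X i : MvPolynomial (Fin m) k))]

/-- The product of the variables is nonzero (private helper). [folklore] -/
private theorem prodX_ne_zero : (∏ i : Fin m, (X i : MvPolynomial (Fin m) k)) ≠ 0 :=
  Finset.prod_ne_zero_iff.mpr fun i _ => X_ne_zero i

/-- **Killing a variable detects a monomial column.** If `A · (X_1⋯X_m) = X_1⋯X_m` then for every
variable `X_j` some column `i` of `A` is supported on the row `j` alone (apply `X_j ↦ 0`: the image of
`X_1⋯X_m` vanishes, so some factor `∑_{j'} A_{j'i} X_{j'}` does; private helper).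
[cite: BurgisserIkenmeyer2017, Prop. 2.4(1)] -/
private theorem exists_col_single_row (A : Matrix (Fin m) (Fin m) k)
    (h : linSubst (Fin m) k A (∏ i : Fin m, X i) = ∏ i : Fin m, X i) (j : Fin m) :
    ∃ i : Fin m, ∀ j' : Fin m, j' ≠ j → A j' i = 0 := by
  classical
  have hkill : aeval (fun l : Fin m => if l = j then (0 : MvPolynomial (Fin m) k) else X l)
      (∏ i : Fin m, (X i : MvPolynomial (Fin m) k)) = 0 := by
    rw [map_prod]
    exact Finset.prod_eq_zero (Finset.mem_univ j) (by rw [aeval_X, if_pos rfl])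
  rw [← h, linSubst_prodX_eq_prod_sum, map_prod, Finset.prod_eq_zero_iff] at hkill
  obtain ⟨i, -, hi⟩ := hkill
  refine ⟨i, fun j' hj' => ?_⟩
  rw [map_sum] at hi
  simp only [map_smul, aeval_X, smul_ite, smul_zero] at hi
  -- evaluate the vanishing linear form at the `j'`-th unit vector
  have hev := congrArg (MvPolynomial.eval fun l : Fin m => if l = j' then (1 : k) else 0) hi
  rw [map_sum, map_zero, Finset.sum_eq_single j'] at hev
  · simpa [hj'] using hev
  · intro x _ hx
    by_cases hxj : x = j
    · rw [if_pos hxj, map_zero]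
    · rw [if_neg hxj, smul_eval, eval_X, if_neg hx, mul_zero]
  · intro hj'
    exact absurd (Finset.mem_univ _) hj'

/-- **Normal form of the stabilizer of `X_1⋯X_m`**: an invertible `γ` whose substitution fixes
`X_1⋯X_m` is a monomial matrix `P_π · diag(c)` with `∏ c_i = 1` (BI 2017, Prop. 2.4(1): "generated
by the permutation matrices and the diagonal matrices with determinant one").
[cite: BurgisserIkenmeyer2017, Prop. 2.4(1)] -/
theorem exists_perm_diagonal_of_mem_linStabilizer_prodX (γ : GL (Fin m) k)
    (hγ : γ ∈ linStabilizer (∏ i : Fin m, (X i : MvPolynomial (Fin m) k))) :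
    ∃ (π : Equiv.Perm (Fin m)) (c : Fin m → k), ∏ i, c i = 1 ∧
      (γ : Matrix (Fin m) (Fin m) k) = π.permMatrix k * diagonal c := by
  classical
  rw [mem_linStabilizer, linSubstRep_apply] at hγ
  -- the row supporting each detected column
  choose f hf using exists_col_single_row (γ : Matrix (Fin m) (Fin m) k) hγ
  -- `f` is injective: a column supported on two different single rows vanishes
  have hinj : Function.Injective f := by
    intro j₁ j₂ h12
    by_contra hne
    have hcol : ∀ j', (γ : Matrix (Fin m) (Fin m) k) j' (f j₁) = 0 := by
      intro j'
      by_cases h1 : j' = j₁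
      · have h2 : j' ≠ j₂ := fun h2 => hne (h1.symm.trans h2)
        rw [h12]
        exact hf j₂ j' h2
      · exact hf j₁ j' h1
    exact Matrix.GeneralLinearGroup.det_ne_zero γ (det_eq_zero_of_column_eq_zero (f j₁) hcol)
  let π : Equiv.Perm (Fin m) := Equiv.ofBijective f (Finite.injective_iff_bijective.mp hinj)
  have hπ : ∀ j, π j = f j := fun j => rfl
  set c : Fin m → k := fun i => (γ : Matrix (Fin m) (Fin m) k) (π.symm i) i with hc
  -- `γ = P_π · diag(c)` entrywise
  have hmat : (γ : Matrix (Fin m) (Fin m) k) = π.permMatrix k * diagonal c := by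
    ext j' i
    rw [mul_diagonal, permMatrix_apply']
    by_cases h : π j' = i
    · rw [if_pos h, one_mul, hc]
      simp only
      rw [← h, Equiv.symm_apply_apply]
    · rw [if_neg h, zero_mul]
      have hne : j' ≠ π.symm i := fun h' => h (by rw [h', Equiv.apply_symm_apply])
      have := hf (π.symm i) j' hne
      rwa [← hπ, Equiv.apply_symm_apply] at this
  refine ⟨π, c, ?_, hmat⟩
  -- `∏ c_i = 1` from `(∏ c_i) · X_1⋯X_m = X_1⋯X_m`
  rw [hmat, linSubst_permMatrix_mul_diagonal_prodX] at hγ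
  have h0 : ((∏ i, c i) - 1) • (∏ i : Fin m, (X i : MvPolynomial (Fin m) k)) = 0 := by
    rw [sub_smul, one_smul, hγ, sub_self]
  rcases smul_eq_zero.mp h0 with h1 | h1
  · exact sub_eq_zero.mp h1
  · exact absurd h1 prodX_ne_zero

/-- The permutation matrix `P_π` as an element of `GL_m` (private helper). [folklore] -/
private theorem exists_gl_coe_eq_permMatrix (π : Equiv.Perm (Fin m)) :
    ∃ P : GL (Fin m) k, (P : Matrix (Fin m) (Fin m) k) = π.permMatrix k :=
  ⟨Matrix.GeneralLinearGroup.mkOfDetNeZero (π.permMatrix k) (by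
    rw [det_permutation]
    rcases Int.units_eq_one_or (Equiv.Perm.sign π) with h1 | h1 <;> simp [h1]),
    Matrix.GeneralLinearGroup.val_mkOfDetNeZero _ _⟩

/-- A det-one diagonal matrix as an element of `GL_m` (private helper). [folklore] -/
private theorem exists_gl_coe_eq_diagonal_of_prod_eq_one (c : Fin m → k) (hc : ∏ i, c i = 1) :
    ∃ D : GL (Fin m) k, (D : Matrix (Fin m) (Fin m) k) = diagonal c :=
  ⟨Matrix.GeneralLinearGroup.mkOfDetNeZero (diagonal c) (by rw [det_diagonal, hc]; exact one_ne_zero),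
    Matrix.GeneralLinearGroup.val_mkOfDetNeZero _ _⟩

/-- **Monomial matrices with `∏ c_i = 1` stabilize `X_1⋯X_m`** (the easy inclusion of Prop. 2.4(1)).
[cite: BurgisserIkenmeyer2017, Prop. 2.4(1)] -/
theorem mem_linStabilizer_prodX_of_coe_eq (γ : GL (Fin m) k) (π : Equiv.Perm (Fin m))
    (c : Fin m → k) (hc : ∏ i, c i = 1)
    (h : (γ : Matrix (Fin m) (Fin m) k) = π.permMatrix k * diagonal c) :
    γ ∈ linStabilizer (∏ i : Fin m, (X i : MvPolynomial (Fin m) k)) := by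
  rw [mem_linStabilizer, linSubstRep_apply, h, linSubst_permMatrix_mul_diagonal_prodX, hc, one_smul]

/-- **BI 2017, Prop. 2.4(1), first sentence, over any field**: the stabilizer of `X_1⋯X_m` in
`GL_m` is generated by the permutation matrices and the diagonal matrices with determinant one.
[cite: BurgisserIkenmeyer2017, Prop. 2.4(1)] -/
theorem linStabilizer_prodX_eq_closure :
    linStabilizer (∏ i : Fin m, (X i : MvPolynomial (Fin m) k)) =
      Subgroup.closure
        ({γ : GL (Fin m) k | ∃ π : Equiv.Perm (Fin m), (γ : Matrix (Fin m) (Fin m) k) = π.permMatrix k} ∪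
         {γ : GL (Fin m) k | ∃ d : Fin m → k, (γ : Matrix (Fin m) (Fin m) k) = Matrix.diagonal d ∧
            ∏ i, d i = 1}) := by
  apply le_antisymm
  · intro γ hγ
    obtain ⟨π, c, hc, hmat⟩ := exists_perm_diagonal_of_mem_linStabilizer_prodX γ hγ
    obtain ⟨P, hP⟩ := exists_gl_coe_eq_permMatrix (k := k) π
    obtain ⟨D, hD⟩ := exists_gl_coe_eq_diagonal_of_prod_eq_one c hc
    have hγPD : γ = P * D := by
      apply Matrix.GeneralLinearGroup.ext
      intro a b
      rw [hmat, Units.val_mul, hP, hD]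
    rw [hγPD]
    exact Subgroup.mul_mem _ (Subgroup.subset_closure (Or.inl ⟨π, hP⟩))
      (Subgroup.subset_closure (Or.inr ⟨c, hD, hc⟩))
  · rw [Subgroup.closure_le]
    rintro γ (⟨π, hπ⟩ | ⟨d, hd, hd1⟩)
    · exact mem_linStabilizer_prodX_of_coe_eq γ π (fun _ => 1) (by simp) (by rw [hπ, diagonal_one, mul_one])
    · exact mem_linStabilizer_prodX_of_coe_eq γ 1 d hd1 (by rw [hd, Matrix.permMatrix_one, one_mul])

/-- **The determinants of the stabilizer of `X_1⋯X_m` are `±1`**, and `-1` occurs once `m ≥ 2`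
(a transposition); so the image of `det` is `{1, -1}`. [cite: BurgisserIkenmeyer2017, Prop. 2.4(1)] -/
theorem mem_stabilizerDetImage_prodX_iff [CharZero k] (hm : 2 ≤ m) (u : kˣ) :
    u ∈ stabilizerDetImage (∏ i : Fin m, (X i : MvPolynomial (Fin m) k)) ↔ u = 1 ∨ u = -1 := by
  rw [mem_stabilizerDetImage_iff]
  constructor
  · rintro ⟨γ, hγ, rfl⟩
    obtain ⟨π, c, hc, hmat⟩ := exists_perm_diagonal_of_mem_linStabilizer_prodX γ hγ
    have hdet : ((Matrix.GeneralLinearGroup.det γ : kˣ) : k) = (Equiv.Perm.sign π : ℤ) := by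
      rw [Matrix.GeneralLinearGroup.val_det_apply, hmat, det_mul, det_permutation, det_diagonal, hc,
        mul_one]
    rcases Int.units_eq_one_or (Equiv.Perm.sign π) with h1 | h1
    · left; apply Units.ext; rw [hdet, h1]; simp
    · right; apply Units.ext; rw [hdet, h1]; simp
  · rintro (rfl | rfl)
    · exact ⟨1, Subgroup.one_mem _, map_one _⟩
    · -- the transposition of the first two variables
      obtain ⟨P, hP⟩ := exists_gl_coe_eq_permMatrix (k := k)
        (Equiv.swap (⟨0, by omega⟩ : Fin m) ⟨1, by omega⟩)
      refine ⟨P, mem_linStabilizer_prodX_of_coe_eq P _ (fun _ => 1) (by simp)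
        (by rw [hP, diagonal_one, mul_one]), ?_⟩
      apply Units.ext
      rw [Matrix.GeneralLinearGroup.val_det_apply, hP, det_permutation,
        Equiv.Perm.sign_swap (by simp [Fin.ext_iff])]
      simp

/-- **BI 2017, Prop. 2.4(1), second sentence, over a field of characteristic zero**: the stabilizer
period of `X_1⋯X_m` is `2` for `m ≥ 2`. [cite: BurgisserIkenmeyer2017, Prop. 2.4(1)] -/
theorem stabilizerPeriod_prodX [CharZero k] (hm : 2 ≤ m) :
    stabilizerPeriod (∏ i : Fin m, (X i : MvPolynomial (Fin m) k)) = 2 := by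
  rw [stabilizerPeriod_def, Nat.card_eq_two_iff]
  have h1 : (1 : kˣ) ∈ stabilizerDetImage (∏ i : Fin m, (X i : MvPolynomial (Fin m) k)) :=
    (mem_stabilizerDetImage_prodX_iff hm 1).mpr (Or.inl rfl)
  have h2 : (-1 : kˣ) ∈ stabilizerDetImage (∏ i : Fin m, (X i : MvPolynomial (Fin m) k)) :=
    (mem_stabilizerDetImage_prodX_iff hm (-1)).mpr (Or.inr rfl)
  refine ⟨⟨1, h1⟩, ⟨-1, h2⟩, ?_, ?_⟩
  · intro h
    have h' : ((1 : kˣ) : k) = ((-1 : kˣ) : k) := by rw [Subtype.ext_iff] at h; exact congrArg Units.val h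
    norm_num at h'
  · ext ⟨u, hu⟩
    simp only [Set.mem_insert_iff, Set.mem_singleton_iff, Set.mem_univ, iff_true]
    rcases (mem_stabilizerDetImage_prodX_iff hm u).mp hu with rfl | rfl
    · exact Or.inl rfl
    · exact Or.inr rfl

/-- **BI 2017, Prop. 2.4(1) — the named fact `BI2017_prop_2_4_1` holds** ("The stabilizer of
`X_1⋯X_m` is generated by the permutation matrices and the diagonal matrices with determinant one.
The stabilizer period of `X_1⋯X_m` equals `2` if `m ≥ 2`"; over `ℂ`, as typed).
[cite: BurgisserIkenmeyer2017, Prop. 2.4(1)] -/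
theorem BI2017_prop_2_4_1_holds : BI2017_prop_2_4_1 :=
  fun _ => ⟨linStabilizer_prodX_eq_closure, fun hm => stabilizerPeriod_prodX hm⟩

end ChowMonomialStabilizer

end Literature.Computability.AlgebraicComplexity
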